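import Mathlib
import Literature.Probability.LatticeModels.ThermodynamicLimit
import Literature.Probability.LatticeModels.SharpnessProofs
import Summits.CriticalPhenomena.Ising3DConformalLimit.Theorems.PrecisionLaplacianDirectCorrelationStableTailScalingOfStableTail
import HarnessLib

/-!
# Helpers (I) for stub `stub_kernelScaling` of line `diffusive-branch-is-nonsaturation`
(crux `PrecisionLaplacian.DirectCorrelationStableTail`, item stmt-CriticalPhenomena-4799)

Infrastructure for the "kernel side at scale" Riemann-sum analysis on `ℝ³ = Fin 3 → ℝ` versus the
lattice `ℤ³ = Site 3`:

* comparisons between the Euclidean norm `|v|₂ = √(∑ vᵢ²)` and Mathlib's sup norm `‖v‖`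
  (reusing `norm_le_sqrt_sum_sq`, `one_le_sqrt_sum_sq`, `sqrt_sum_sq_intCast_div` of the landed
  `…PointwiseUpgradeAux` / `…ScalingOfStableTail` files);
* the coordinatewise floor map `v ↦ ⌊R v⌋ ∈ ℤ³` at scale `R ∈ ℕ`, its fibres (the cells
  `∏ᵢ [xᵢ/R, (xᵢ+1)/R)` of volume `R⁻³`), and the **floor-sum identity**
  `∫ F(⌊R v⌋) dv = R⁻³ ∑_{x ∈ ℤ³} F(x)` together with `Summable F`, for every `F : ℤ³ → ℝ` such that
  `v ↦ F(⌊R v⌋)` is integrable (registered helper sub-goal `stub_kernelScaling_auxFloorSum`);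
* the radial integral `∫_{‖v‖ ≤ r} ‖v‖^β dv = 3 |B₁| r^{β+3}/(β+3)` (`β > -3`) for the sup norm,
  Gaussian integrability on `Fin 3 → ℝ`, and integrability of `|v|₂^{α-3} ×` (Gaussian envelope).

All statements are folklore; no definitions are introduced.
-/

noncomputable section

namespace Summit.CriticalPhenomena.Ising3DConformalLimit.Cruxes.DirectCorrelationStableTail.DiffusiveBranchIsNonsaturation

open MeasureTheory Filter Topology
open scoped BigOperators
open Literature.Probability.LatticeModels
open Summit.CriticalPhenomena.Ising3DConformalLimit.Cruxes.DirectCorrelationStableTail.SelfEnergyPickInversion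

/-! ### The Euclidean norm `√(∑ vᵢ²)` on `Fin 3 → ℝ` -/

/-- `√(∑ vᵢ²)` is the norm of `v` viewed in `EuclideanSpace ℝ (Fin 3)`. [folklore] -/
theorem kernSc_euclid_eq_norm_toLp (v : Fin 3 → ℝ) :
    √(∑ i, v i ^ 2) = ‖(WithLp.toLp 2 v : EuclideanSpace ℝ (Fin 3))‖ := by
  rw [EuclideanSpace.norm_eq]
  simp [Real.norm_eq_abs, sq_abs]

/-- The Euclidean norm is at most `√3` times the sup norm. [folklore] -/
theorem kernSc_euclid_le_sqrt_three_mul_norm (v : Fin 3 → ℝ) : √(∑ i, v i ^ 2) ≤ √3 * ‖v‖ := by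
  have h : ∀ i, v i ^ 2 ≤ ‖v‖ ^ 2 := fun i => by
    rw [← sq_abs]
    have hi : |v i| ≤ ‖v‖ := by simpa [Real.norm_eq_abs] using norm_le_pi_norm v i
    exact pow_le_pow_left₀ (abs_nonneg _) hi 2
  have hs : ∑ i, v i ^ 2 ≤ 3 * ‖v‖ ^ 2 :=
    calc ∑ i, v i ^ 2 ≤ ∑ _i : Fin 3, ‖v‖ ^ 2 := Finset.sum_le_sum fun i _ => h i
      _ = 3 * ‖v‖ ^ 2 := by simp
  calc √(∑ i, v i ^ 2) ≤ √(3 * ‖v‖ ^ 2) := Real.sqrt_le_sqrt hs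
    _ = √3 * ‖v‖ := by rw [Real.sqrt_mul (by norm_num), Real.sqrt_sq (norm_nonneg _)]

/-- The Euclidean norm is `1`-Lipschitz for itself: `| |v|₂ - |w|₂ | ≤ |v - w|₂`. [folklore] -/
theorem kernSc_abs_euclid_sub_euclid_le (v w : Fin 3 → ℝ) :
    |√(∑ i, v i ^ 2) - √(∑ i, w i ^ 2)| ≤ √(∑ i, (v i - w i) ^ 2) := by
  have e : √(∑ i, (v i - w i) ^ 2) =
      ‖(WithLp.toLp 2 v : EuclideanSpace ℝ (Fin 3)) - WithLp.toLp 2 w‖ := by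
    rw [← WithLp.toLp_sub, ← kernSc_euclid_eq_norm_toLp]
    rfl
  rw [kernSc_euclid_eq_norm_toLp, kernSc_euclid_eq_norm_toLp, e]
  exact abs_norm_sub_norm_le _ _

/-- For a non-positive exponent the Euclidean power is dominated by the sup-norm power (both vanish
at `v = 0` for `β ≠ 0` by the `Real.rpow` convention). [folklore] -/
theorem kernSc_euclid_rpow_le_norm_rpow {β : ℝ} (hβ : β < 0) (v : Fin 3 → ℝ) :
    √(∑ i, v i ^ 2) ^ β ≤ ‖v‖ ^ β := by
  by_cases hv : v = 0
  · subst hv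
    simp [Real.zero_rpow hβ.ne]
  · exact Real.rpow_le_rpow_of_nonpos (norm_pos_iff.2 hv) (norm_le_sqrt_sum_sq v) hβ.le

/-- The Euclidean power `v ↦ |v|₂^β` is measurable. [folklore] -/
theorem kernSc_measurable_euclid_rpow (β : ℝ) :
    Measurable (fun v : Fin 3 → ℝ => √(∑ i, v i ^ 2) ^ β) :=
  (Real.continuous_sqrt.measurable.comp (by fun_prop)).pow_const β

/-! ### The coordinatewise floor map at scale `R` -/

/-- Rounding error of one coordinate: `0 ≤ s - ⌊R s⌋/R ≤ 1/R`. [folklore] -/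
theorem kernSc_sub_floor_div_mem {R : ℝ} (hR : 0 < R) (s : ℝ) :
    0 ≤ s - (⌊R * s⌋ : ℝ) / R ∧ s - (⌊R * s⌋ : ℝ) / R ≤ 1 / R := by
  have h1 := Int.floor_le (R * s)
  have h2 := Int.lt_floor_add_one (R * s)
  constructor
  · rw [sub_nonneg, div_le_iff₀ hR]
    linarith [mul_comm R s]
  · rw [sub_le_iff_le_add, ← add_div, le_div_iff₀ hR]
    linarith [mul_comm R s]

/-- The floor map moves a point by at most `1/R` in sup norm. [folklore] -/
theorem kernSc_norm_sub_floor_le {R : ℝ} (hR : 0 < R) (v : Fin 3 → ℝ) :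
    ‖v - fun i => (⌊R * v i⌋ : ℝ) / R‖ ≤ 1 / R :=
  (pi_norm_le_iff_of_nonneg (by positivity)).2 fun i => by
    rw [Pi.sub_apply, Real.norm_eq_abs, abs_of_nonneg (kernSc_sub_floor_div_mem hR (v i)).1]
    exact (kernSc_sub_floor_div_mem hR (v i)).2

/-- The floor map moves a point by at most `√3/R ≤ 2/R` in Euclidean norm. [folklore] -/
theorem kernSc_euclid_sub_floor_le {R : ℝ} (hR : 0 < R) (v : Fin 3 → ℝ) :
    √(∑ i, (v i - (⌊R * v i⌋ : ℝ) / R) ^ 2) ≤ 2 / R := by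
  have h := kernSc_euclid_le_sqrt_three_mul_norm (v - fun i => (⌊R * v i⌋ : ℝ) / R)
  have h3 : √3 ≤ 2 := by
    rw [show (2 : ℝ) = √4 by rw [show (4 : ℝ) = 2 ^ 2 by norm_num, Real.sqrt_sq zero_le_two]]
    exact Real.sqrt_le_sqrt (by norm_num)
  calc √(∑ i, (v i - (⌊R * v i⌋ : ℝ) / R) ^ 2) ≤ √3 * ‖v - fun i => (⌊R * v i⌋ : ℝ) / R‖ := h
    _ ≤ 2 * (1 / R) :=
        mul_le_mul h3 (kernSc_norm_sub_floor_le hR v) (norm_nonneg _) zero_le_two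
    _ = 2 / R := by ring

/-- The floor map `v ↦ ⌊R v⌋ ∈ ℤ³` is measurable. [folklore] -/
theorem kernSc_measurable_floorMap (R : ℝ) :
    Measurable (fun v : Fin 3 → ℝ => (fun i => ⌊R * v i⌋ : Site 3)) :=
  measurable_pi_lambda _ fun i =>
    Int.measurable_floor.comp (by fun_prop : Measurable fun v : Fin 3 → ℝ => R * v i)

/-- The fibre of the floor map over `x ∈ ℤ³` is the cell `∏ᵢ [xᵢ/R, (xᵢ+1)/R)`. [folklore] -/
theorem kernSc_floorMap_preimage {R : ℝ} (hR : 0 < R) (x : Site 3) :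
    (fun v : Fin 3 → ℝ => (fun i => ⌊R * v i⌋ : Site 3)) ⁻¹' {x} =
      Set.univ.pi fun i => Set.Ico ((x i : ℝ) / R) (((x i : ℝ) + 1) / R) := by
  ext v
  simp only [Set.mem_preimage, Set.mem_singleton_iff, Set.mem_univ_pi, Set.mem_Ico]
  rw [funext_iff]
  refine forall_congr' fun i => ?_
  rw [Int.floor_eq_iff, div_le_iff₀ hR, lt_div_iff₀ hR, mul_comm (v i) R]

/-- Each cell of the floor map at scale `R` has volume `R⁻³`. [folklore] -/
theorem kernSc_volume_floorMap_fiber {R : ℝ} (hR : 0 < R) (x : Site 3) :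
    volume ((fun v : Fin 3 → ℝ => (fun i => ⌊R * v i⌋ : Site 3)) ⁻¹' {x}) =
      ENNReal.ofReal ((R ^ 3)⁻¹) := by
  rw [kernSc_floorMap_preimage hR x, Real.volume_pi_Ico]
  have h : ∀ i : Fin 3, ((x i : ℝ) + 1) / R - (x i : ℝ) / R = R⁻¹ := fun i => by
    field_simp
    ring
  simp only [h, Finset.prod_const, Finset.card_univ, Fintype.card_fin]
  rw [← ENNReal.ofReal_pow (inv_nonneg.2 hR.le), inv_pow]

/-- **Floor-sum identity** (lattice sums as integrals of step functions).  If `v ↦ F(⌊R v⌋)` is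
integrable on `ℝ³` (`R > 0`), then `F` is summable over `ℤ³` and `∫ F(⌊R v⌋) dv = R⁻³ ∑ₓ F(x)`:
push the Lebesgue measure forward along the floor map, whose fibres all have volume `R⁻³`.
[folklore] -/
theorem kernSc_integral_floor {R : ℝ} (hR : 0 < R) (F : Site 3 → ℝ)
    (hF : Integrable (fun v : Fin 3 → ℝ => F (fun i => ⌊R * v i⌋))) :
    Summable F ∧ ∫ v : Fin 3 → ℝ, F (fun i => ⌊R * v i⌋) = (R ^ 3)⁻¹ * ∑' x, F x := by
  set fl : (Fin 3 → ℝ) → Site 3 := fun v i => ⌊R * v i⌋ with hfl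
  have hmeas : Measurable fl := kernSc_measurable_floorMap R
  set ν : Measure (Site 3) := Measure.map fl volume with hν
  have hνx : ∀ x, ν {x} = ENNReal.ofReal ((R ^ 3)⁻¹) := fun x => by
    rw [hν, Measure.map_apply hmeas (measurableSet_singleton x)]
    exact kernSc_volume_floorMap_fiber hR x
  have hFm : AEStronglyMeasurable F ν := (measurable_of_countable F).aestronglyMeasurable
  have hFν : Integrable F ν := (integrable_map_measure hFm hmeas.aemeasurable).2 hF
  refine ⟨?_, ?_⟩
  · have hlint : ∫⁻ x, ‖F x‖ₑ ∂ν < ⊤ := hFν.hasFiniteIntegral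
    rw [lintegral_countable'] at hlint
    simp only [hνx] at hlint
    rw [ENNReal.tsum_mul_right] at hlint
    have hne : (∑' x, ‖F x‖ₑ) ≠ ⊤ := by
      intro htop
      rw [htop, ENNReal.top_mul (by simp [hR])] at hlint
      exact lt_irrefl _ hlint
    have hs : Summable (fun x => ‖F x‖₊) := ENNReal.tsum_coe_ne_top_iff_summable.1 hne
    exact (NNReal.summable_coe.2 hs).of_norm
  · rw [← integral_map hmeas.aemeasurable hFm, integral_countable hFν]
    simp only [measureReal_def, hνx, ENNReal.toReal_ofReal (inv_nonneg.2 (pow_nonneg hR.le 3)),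
      smul_eq_mul]
    exact tsum_mul_left

/-- **Registered helper sub-goal `stub_kernelScaling_auxFloorSum`** of stub `stub_kernelScaling`
(line `diffusive-branch-is-nonsaturation`, crux stmt-CriticalPhenomena-4799): the floor-sum
identity `∫ F(⌊R v⌋) dv = R⁻³ ∑ₓ F(x)` on `ℝ³`, with summability of `F`, whenever the step function
`v ↦ F(⌊R v⌋)` is integrable. [folklore] -/
theorem stub_kernelScaling_auxFloorSum :
    ∀ (R : ℝ) (F : Site 3 → ℝ), 0 < R →
      MeasureTheory.Integrable (fun v : Fin 3 → ℝ => F (fun i => ⌊R * v i⌋)) →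
      Summable F ∧ ∫ v : Fin 3 → ℝ, F (fun i => ⌊R * v i⌋) = (R ^ 3)⁻¹ * ∑' x, F x :=
  fun _R F hR hF => kernSc_integral_floor hR F hF

/-! ### Radial and Gaussian integrals on `Fin 3 → ℝ` -/

/-- **Radial power integral for the sup norm.**  For `β > -3` and `r > 0`,
`v ↦ 𝟙{‖v‖ ≤ r} ‖v‖^β` is integrable on `ℝ³` and its integral is `3 |B₁| r^{β+3}/(β+3)`
(`|B₁|` the volume of the unit sup-norm ball), by Mathlib's polar formula
`integral_fun_norm_addHaar`. [folklore] -/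
theorem kernSc_integral_norm_rpow_ball {β : ℝ} (hβ : -3 < β) {r : ℝ} (hr : 0 < r) :
    Integrable (fun v : Fin 3 → ℝ =>
        (Metric.closedBall (0 : Fin 3 → ℝ) r).indicator (fun v => ‖v‖ ^ β) v) ∧
      ∫ v : Fin 3 → ℝ, (Metric.closedBall (0 : Fin 3 → ℝ) r).indicator (fun v => ‖v‖ ^ β) v =
        3 * (volume : Measure (Fin 3 → ℝ)).real (Metric.ball 0 1) * (r ^ (β + 3) / (β + 3)) := by
  have hfun : (fun v : Fin 3 → ℝ =>
      (Metric.closedBall (0 : Fin 3 → ℝ) r).indicator (fun v => ‖v‖ ^ β) v) =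
      fun v => (Set.Iic r).indicator (fun y => y ^ β) ‖v‖ := by
    funext v
    by_cases hv : ‖v‖ ≤ r
    · rw [Set.indicator_of_mem (mem_closedBall_zero_iff.2 hv),
        Set.indicator_of_mem (Set.mem_Iic.2 hv)]
    · rw [Set.indicator_of_notMem (fun h => hv (mem_closedBall_zero_iff.1 h)),
        Set.indicator_of_notMem (fun h => hv (Set.mem_Iic.1 h))]
  have hdim : Module.finrank ℝ (Fin 3 → ℝ) = 3 := Module.finrank_fin_fun ℝ
  -- the one-dimensional profile on `(0, ∞)`
  have hprof : ∀ y ∈ Set.Ioi (0 : ℝ), y ^ (3 - 1) • (Set.Iic r).indicator (fun y => y ^ β) y =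
      (Set.Iic r).indicator (fun y => y ^ (β + 2)) y := by
    intro y hy
    rw [smul_eq_mul]
    by_cases hyr : y ≤ r
    · rw [Set.indicator_of_mem (Set.mem_Iic.2 hyr), Set.indicator_of_mem (Set.mem_Iic.2 hyr),
        Real.rpow_add hy, Real.rpow_two]
      ring
    · rw [Set.indicator_of_notMem (fun h => hyr (Set.mem_Iic.1 h)),
        Set.indicator_of_notMem (fun h => hyr (Set.mem_Iic.1 h)), mul_zero]
  have hβ2 : -1 < β + 2 := by linarith
  have hIoc : IntegrableOn (fun y : ℝ => y ^ (β + 2)) (Set.Ioc 0 r) :=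
    (intervalIntegrable_iff_integrableOn_Ioc_of_le hr.le).1
      (intervalIntegral.intervalIntegrable_rpow' hβ2)
  have hint1 : IntegrableOn (fun y : ℝ => y ^ (3 - 1) • (Set.Iic r).indicator (fun y => y ^ β) y)
      (Set.Ioi 0) := by
    refine IntegrableOn.congr_fun ?_ (fun y hy => (hprof y hy).symm) measurableSet_Ioi
    rw [IntegrableOn, integrable_indicator_iff measurableSet_Iic, IntegrableOn,
      Measure.restrict_restrict measurableSet_Iic, Set.Iic_inter_Ioi]
    exact hIoc
  refine ⟨?_, ?_⟩
  · rw [hfun, integrable_fun_norm_addHaar volume (f := (Set.Iic r).indicator fun y => y ^ β), hdim]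
    exact hint1
  · rw [hfun, integral_fun_norm_addHaar volume ((Set.Iic r).indicator fun y => y ^ β), hdim,
      setIntegral_congr_fun measurableSet_Ioi hprof, setIntegral_indicator measurableSet_Iic,
      Set.Ioi_inter_Iic, ← intervalIntegral.integral_of_le hr.le, integral_rpow (Or.inl hβ2),
      Real.zero_rpow (by linarith), sub_zero, nsmul_eq_mul, smul_eq_mul,
      show β + 2 + 1 = β + 3 by ring]
    push_cast
    ring

/-- Gaussian integrability on `ℝ³` (product of three one-dimensional Gaussians), in the shifted form
`v ↦ exp(-b |v + s|₂²)`. [folklore] -/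
theorem kernSc_integrable_gauss {b : ℝ} (hb : 0 < b) (s : Fin 3 → ℝ) :
    Integrable (fun v : Fin 3 → ℝ => Real.exp (-(b * ∑ i, (v i + s i) ^ 2))) := by
  have h0 : Integrable (fun v : Fin 3 → ℝ => Real.exp (-(b * ∑ i, v i ^ 2))) := by
    have h := Integrable.fintype_prod (ι := Fin 3) (f := fun _ x => Real.exp (-b * x ^ 2))
      (μ := fun _ => (volume : Measure ℝ)) (fun _ => integrable_exp_neg_mul_sq hb)
    rw [← volume_pi] at h
    refine h.congr (ae_of_all _ fun v => ?_)
    simp only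
    rw [← Real.exp_sum, Finset.mul_sum, ← Finset.sum_neg_distrib]
    simp [neg_mul]
  exact h0.comp_add_right s

/-- Integrability of the Riesz kernel against a Gaussian envelope: if `|g| ≤ A e^{-b|· + s|₂²}`
with `g` (ae strongly) measurable, then `v ↦ |v|₂^{α-3} g(v)` is integrable on `ℝ³` for
`0 < α` (local integrability of `‖v‖^{α-3}` near `0`, boundedness of the kernel by `1` outside the
unit ball). [folklore] -/
theorem kernSc_integrable_kernel_mul {α : ℝ} (hα0 : 0 < α) (hα3 : α < 3) {g : (Fin 3 → ℝ) → ℝ}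
    (hg : AEStronglyMeasurable g) {b A : ℝ} (hb : 0 < b) (hA : 0 ≤ A) (s : Fin 3 → ℝ)
    (hbound : ∀ v, |g v| ≤ A * Real.exp (-(b * ∑ i, (v i + s i) ^ 2))) :
    Integrable (fun v : Fin 3 → ℝ => √(∑ i, v i ^ 2) ^ (α - 3) * g v) := by
  have hball := (kernSc_integral_norm_rpow_ball (β := α - 3) (by linarith) one_pos).1
  have hgauss := kernSc_integrable_gauss hb s
  refine Integrable.mono' ((hball.add hgauss).const_mul A)
    ((kernSc_measurable_euclid_rpow (α - 3)).aestronglyMeasurable.mul hg)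
    (ae_of_all _ fun v => ?_)
  have hneg : α - 3 < 0 := by linarith
  have hN : 0 ≤ √(∑ i, v i ^ 2) ^ (α - 3) := Real.rpow_nonneg (Real.sqrt_nonneg _) _
  have he0 : 0 ≤ Real.exp (-(b * ∑ i, (v i + s i) ^ 2)) := (Real.exp_pos _).le
  have he1 : Real.exp (-(b * ∑ i, (v i + s i) ^ 2)) ≤ 1 := by
    rw [Real.exp_le_one_iff, neg_nonpos]
    exact mul_nonneg hb.le (Finset.sum_nonneg fun i _ => sq_nonneg _)
  have hind : 0 ≤ (Metric.closedBall (0 : Fin 3 → ℝ) 1).indicator (fun v => ‖v‖ ^ (α - 3)) v :=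
    Set.indicator_nonneg (fun w _ => Real.rpow_nonneg (norm_nonneg w) _) v
  rw [Real.norm_eq_abs, abs_mul, abs_of_nonneg hN, Pi.add_apply]
  by_cases hv : ‖v‖ ≤ 1
  · rw [Set.indicator_of_mem (mem_closedBall_zero_iff.2 hv)]
    calc √(∑ i, v i ^ 2) ^ (α - 3) * |g v|
        ≤ ‖v‖ ^ (α - 3) * (A * Real.exp (-(b * ∑ i, (v i + s i) ^ 2))) :=
          mul_le_mul (kernSc_euclid_rpow_le_norm_rpow hneg v) (hbound v) (abs_nonneg _)
            (Real.rpow_nonneg (norm_nonneg _) _)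
      _ ≤ ‖v‖ ^ (α - 3) * (A * 1) := by gcongr
      _ ≤ A * (‖v‖ ^ (α - 3) + Real.exp (-(b * ∑ i, (v i + s i) ^ 2))) := by nlinarith
  · push Not at hv
    have h1 : √(∑ i, v i ^ 2) ^ (α - 3) ≤ 1 :=
      Real.rpow_le_one_of_one_le_of_nonpos (hv.le.trans (norm_le_sqrt_sum_sq v)) hneg.le
    calc √(∑ i, v i ^ 2) ^ (α - 3) * |g v|
        ≤ 1 * (A * Real.exp (-(b * ∑ i, (v i + s i) ^ 2))) :=
          mul_le_mul h1 (hbound v) (abs_nonneg _) zero_le_one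
      _ ≤ A * ((Metric.closedBall (0 : Fin 3 → ℝ) 1).indicator (fun v => ‖v‖ ^ (α - 3)) v +
          Real.exp (-(b * ∑ i, (v i + s i) ^ 2))) := by nlinarith

end Summit.CriticalPhenomena.Ising3DConformalLimit.Cruxes.DirectCorrelationStableTail.DiffusiveBranchIsNonsaturation

end
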